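import Summits.HodgeConjecture.HodgeConjecture.Theorems.Ring2AbelianAllAndreFibreClassPrimitiveParts
import Summits.HodgeConjecture.HodgeConjecture.Theorems.Ring2AbelianAllAndreWeilPencilsCodim
import Literature.AlgebraicGeometry.Motives.HodgeStructureDirectSum
import HarnessLib

/-!
# Ring 2 · sub-cell AbelianAll (ALL ABELIAN VARIETIES), André axis, part XII-b — Deligne's kernel
# identity (κ) `j_{t*} j_t^* W = 0 ⟹ j_s^* W = 0` for every compact pencil of abelian varieties, FROM THE
# NAMED FACT `deligne1968_invariantClass_fromTotalSpace` (Voisin II Thm. 4.18) and the tree's polarisation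
# of the fibre: every `K[κ]` row of the Lefschetz column becomes `K[h418]`

HONEST FRAMING (page 1, verbatim): **research route, not a corollary; conditional on HC_CM plus one named
minimal statement.** Cell line: research route conditional on HC_CM; not a corollary; Q11.4-sentence-2
already refuted in dim ≥ 3. Nothing in this file proves a case of the Hodge conjecture for an abelian variety.
`HC_CM` = `Theses.RankFourFaces.CMAbelianHodge`, `HC_AV` = `Theses.PadicSemiregularLift.HodgeAbelianVarieties`,
item `Theses.RankFourFaces.CMToAbelian` (stmt-16267) OPEN and not closed here. Seat `pub-hodge-ring2-ab-andre-2`,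
gen 4; owed item o9 of RING2-MAP §AbelianAll AA2.22 — DONE: the supply node (κ) `FibreGysinKernelCompactPencils`
of parts X-b/X-c (typed there as an OPEN HYPOTHESIS, "print-true, no carrier") is DERIVED from
`h418 : deligne1968_invariantClass_fromTotalSpace` — a NAMED FACT already in the tree with its citation
(Deligne 1968 (2.1)+(2.6.3) / Voisin II Thm. 4.18: "the restriction map `Hᵏ(X, ℚ) → Hᵏ(X_y, ℚ)^{inv}` is
surjective"), displayed as a hypothesis — and tree THEOREMS.

## The argument (de Cataldo 2007, Ex. 8.5.2–8.5.3, made honest on the carriers)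

Fix a compact pencil `f : 𝒳 ⟶ S` of abelian `d`-folds (`d ≥ 1`; `d = 0` is part XI), a point `t`, `j = j_t`,
`k = 2p ≤ 2d`, and `a = j^* W` with `j_* a = 0`. Let `I = Im(j^* : H•(𝒳) → H•(X_t))`.
1. (part XII-a) A global class `K` restricts on `X_t` to the Kähler class of a Kähler–rational datum `D` and has
   hard Lefschetz on every fibre; by `h418` the image `I` is stable under the primitive projections `ξ_P` of
   `(X_t, K|_{X_t})`; it is stable under `L` trivially (`j^*` is multiplicative).
2. (§1, LINK) `j_*(j^* y ∪ a) = y ∪ j_* a = 0` (projection formula, `complexGysin_cup`) and `j_*` is INJECTIVE on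
   the top degree `H^{2d}(X_t)` (part XI), so `z ∪ a = 0` for every `z ∈ I^{2d-k}`. The polarisation form of `D`
   is `Q(w, a) = ∑_P ± τ(L^{d-a'} ξ_P w ∪ ξ_P a)`, and by the cup-product bridge of part XII-a
   `L^{d-a'} ξ_P w ∪ ξ_P a = (L^{d-a'-t'} ξ_P w) ∪ a = z ∪ a` with `z ∈ I` — so **`Q(w, a) = 0` for all `w ∈ I`**.
3. (§2) `I ⊗ ℂ`-structure: `I` is the complexification of the image of the morphism of `ℚ`-HODGE STRUCTURES
   `j^* : Hᵏ(𝒳(ℂ); ℚ) → Hᵏ(X_t(ℂ); ℚ)` (tree: `HodgeModel.hodgeStructureHom`), a sub-Hodge structure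
   (`Hom.exists_subHodgeStructure_range`), and `Q` is the complexification of the POLARISATION `D.polarization`
   of `Hᵏ(X_t(ℂ); ℚ)` (tree: Voisin I §7.1.2, `HodgeRiemannPolarizabilityProofs`). A polarisation is
   non-degenerate on every sub-Hodge structure (`Polarization.eq_zero_of_forall_mem_baseChange`, Voisin 2025
   Prop. 2.11): `a = 0`.
4. (§3) change of fibre (André's flatness (A4), tree): `j_s^* W = 0` for all `s`. Hence (κ_f), (κ); and every
   `K[κ]` row of parts X-b … XI — `HC ⟹ (β∀′ᵖᵗ)`, `HC^{d}(𝒳 × 𝒳) ⟹ (β′ᵖᵗ_f)`, the ladder, the W₆ rows —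
   restated modulo `h418` (and φ where it was needed).

HONEST LIMITS: `h418` is a published theorem NOT proved in the tree (Leray degeneration); it is the ONLY
non-kernel input of (κ) after this part. (φ) (fibre-class constancy) is untouched. Nothing here is a case of HC.

References: VoisinHodgeII2003 (Thm. 4.15, Lemma 4.17, Thm. 4.18); Deligne1968 ((2.1), (2.6.3)); DeligneHodgeII1971
(4.1.1, 4.2.6); Decataldo2007 (Ex. 8.5.2–8.5.3); VoisinHodgeI2002 (§6.3.2 Thm. 6.32, §7.1.2, Lemma 7.26,
§7.3.1–7.3.2); Voisin2025 (Prop. 2.11); FultonYoungTableaux1997 (App. B (6)); Andre1996Motifs (§5.1, Remarque 2).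
-/

noncomputable section

set_option linter.dupNamespace false

namespace Summit.HodgeConjecture.HodgeConjecture.Ring2.AbelianAll

open CategoryTheory AlgebraicGeometry MonoidalCategory
open scoped TensorProduct
open Literature.AlgebraicGeometry Literature.AlgebraicGeometry.Motives
open Literature.AlgebraicGeometry.HodgeTheory
open Literature.AlgebraicTopology.SingularHomology (singularCohomology cupProduct cupProduct_map)
open Literature.Geometry.Kaehler (lefschetzOperator HasHardLefschetzProperty)
open Summit.HodgeConjecture.HodgeConjecture
open Summit.HodgeConjecture.HodgeConjecture.Theses

variable {𝒳 S : SchemeOver ℂ}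

/-! ## §1 The link: `j_* a = 0` kills the polarisation form against the image of restriction -/

/-- **`j_t^* y ∪ a = 0` in the top degree whenever `j_{t*} a = 0`**: `j_{t*}(j_t^* y ∪ a) = y ∪ j_{t*} a = 0`
(projection formula, the tree's `complexGysin_cup`) and `j_{t*}` is injective on `H^{2d}(X_t(ℂ); ℂ)` (part XI,
`fiberGysin_top_injective`). [cite: FultonYoungTableaux1997, Appendix B §B.1 (6)] [cite: HatcherAT2002, §3.3 Prop. 3.38] -/
theorem cupProduct_map_fiberι_eq_zero_of_fiberGysin_eq_zero {d : ℕ} {f : 𝒳 ⟶ S} (hf : IsCompactAbelianPencil f d)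
    (t : ComplexPoints S) {p q : ℕ} (hq : q + 2 * p = 2 * d) (y : complexBetti 𝒳 q)
    {a : complexBetti (fiberOver f t) (2 * p)} (ha : fiberGysin hf t p a = 0) :
    cupProduct hq (complexBetti.map (fiberι f t) q y) a = 0 := by
  have h := complexGysin_cup (μ := complexOrientationFamily) hasPoincareDuality_complexOrientationFamily
    (hf.isSmoothProjective_fiberOver t) hf.isSmoothProjective_total (fiberι f t) hq
    (show 2 * d + 2 * (d + 1) = 2 * (d + 1) + 2 * d by ring)
    (show 2 * p + 2 * (d + 1) = 2 * (p + 1) + 2 * d by ring)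
    (show q + 2 * (p + 1) = 2 * (d + 1) by omega) y a
  have ha' : complexGysin complexOrientationFamily (hf.isSmoothProjective_fiberOver t) hf.isSmoothProjective_total
      (fiberι f t) (show 2 * p + 2 * (d + 1) = 2 * (p + 1) + 2 * d by ring) a = 0 := ha
  rw [ha', map_zero] at h
  exact fiberGysin_top_injective hf t h

/-- Pull-back to a fibre commutes with the Lefschetz iterates of a global class and of its restriction:
`j_t^*(L_Kˢ B) = L_{K|X_t}ˢ (j_t^* B)`. [cite: HatcherAT2002, §3.2 Prop. 3.10] -/
theorem map_fiberι_lefschetzPowTo {f : 𝒳 ⟶ S} (t : ComplexPoints S) (K : complexBetti 𝒳 2)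
    (s a m : ℕ) (h : a + 2 * s = m) (B : complexBetti 𝒳 a) :
    complexBetti.map (fiberι f t) m (lefschetzPowTo K s a m h B) =
      lefschetzPowTo (complexBetti.map (fiberι f t) 2 K) s a m h (complexBetti.map (fiberι f t) a B) :=
  map_lefschetzPowTo_of_semiconj (fun j ↦ (complexBetti.map (fiberι f t) j).hom.toAddMonoidHom)
    (semiconj_lefschetzOperator_map (Motives.AlgPoints.mapContinuous (L := ℂ) (fiberι f t)) K) s a m h B

/-- **THE LINK.** For a compact pencil of abelian `d`-folds, a global class `K` with hard Lefschetz on every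
fibre and restricting on `X_t` to the Kähler class of the Kähler–rational datum `D`, and `a = j_t^* W ∈ H²ᵖ(X_t)`
with `j_{t*} a = 0`: **the polarisation form of `D` vanishes against the whole image of restriction**,
`Q_D(j_t^* W', a) = 0` for every global `W'` — granted the named fact `h418`. Each Lefschetz term
`± τ(L^{d-a'} ξ_P(j^* W') ∪ ξ_P a)` equals `± τ(z ∪ a)` with `z = L^{d-a'-t'} ξ_P(j^* W') = j^*(L^{d-a'-t'} B)`
(`ξ_P(j^* W') = j^* B` by part XII-a's stability), and `j^* y ∪ a = 0`. [cite: Decataldo2007, Ex. 8.5.2–8.5.3]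
[cite: VoisinHodgeI2002, §6.3.2 Thm. 6.32 and Lemma 6.29] [cite: VoisinHodgeII2003, §4.3.1 Thm. 4.18] -/
theorem cform_map_fiberι_eq_zero_of_fiberGysin_eq_zero (h418 : deligne1968_invariantClass_fromTotalSpace)
    {d : ℕ} {f : 𝒳 ⟶ S} (hf : IsCompactAbelianPencil f d) (t : ComplexPoints S)
    {K : complexBetti 𝒳 2} (hK : ∀ s : ComplexPoints S, HasHardLefschetzProperty (complexBetti.map (fiberι f s) 2 K) d)
    (D : KaehlerRationalDatum d (fiberOver f t)) (hKD : complexBetti.map (fiberι f t) 2 K = D.Hη)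
    {p : ℕ} {W : complexBetti 𝒳 (2 * p)}
    (hW : fiberGysin hf t p (complexBetti.map (fiberι f t) (2 * p) W) = 0) (W' : complexBetti 𝒳 (2 * p)) :
    D.cform (hf.isSmoothProjective_fiberOver t) (2 * p) (complexBetti.map (fiberι f t) (2 * p) W')
      (complexBetti.map (fiberι f t) (2 * p) W) = 0 := by
  classical
  set hXt := hf.isSmoothProjective_fiberOver t
  rw [KaehlerRationalDatum.cform, polarizationForm_apply]
  refine Finset.sum_eq_zero fun P _ ↦ ?_
  rcases le_or_gt (P.1.1 + P.1.2) d with hP | hP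
  · -- the `P`-term: `± τ(L^{d-a'} ξ_P(j^*W') ∪ ξ_P(j^*W)) = ± τ(j^*(L^{d-a'-t'} B) ∪ j^*W) = 0`
    have hP2 := P.2
    obtain ⟨s, hs⟩ : ∃ s, P.1.1 + s = d := ⟨d - P.1.1, by omega⟩
    obtain ⟨s', hs'⟩ : ∃ s', P.1.1 + P.1.2 + s' = d := ⟨d - (P.1.1 + P.1.2), by omega⟩
    rw [hodgeRiemannPairing_apply _ hs rfl (by omega : (P.1.1 + 2 * s) + P.1.1 = 2 * d),
      cupProduct_lefschetzPowTo_primitivePart_eq D.Hη (D.hLℂ hXt) (subsingleton_of_lt hXt ℂ) P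
        (primitivePart_mem _ _ P _) _ hs rfl _ hs' rfl (by omega : (P.1.1 + 2 * s') + 2 * p = 2 * d)]
    -- `ξ_P(j^* W') = j^* B`
    obtain ⟨B, hB⟩ := exists_primitivePart_map_fiberι_eq h418 hf K hK W' P t
    rw [primitivePart_congr hKD (hK t) (D.hLℂ hXt) (hvan_fiberOver hf t) P] at hB
    rw [hB, ← hKD, ← map_fiberι_lefschetzPowTo t K s' P.1.1 (P.1.1 + 2 * s') rfl B,
      cupProduct_map_fiberι_eq_zero_of_fiberGysin_eq_zero hf t (by omega) _ hW, map_zero, mul_zero]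
  · rw [primitivePart_of_lt _ _ P hP, LinearMap.zero_apply, LinearMap.zero_apply, LinearMap.map_zero₂]

/-! ## §2 Non-degeneracy: the image of restriction underlies a polarised sub-Hodge structure -/

section RationalStructure

variable {V V' : Type} [AddCommGroup V] [Module ℚ V] [AddCommGroup V'] [Module ℚ V']

/-- `g_ℂ x ∈ (im g)_ℂ` for a `ℚ`-linear `g` and every `x ∈ ℂ ⊗ V'`. [folklore] -/
theorem baseChange_mem_baseChange_range (g : V' →ₗ[ℚ] V) (x : ℂ ⊗[ℚ] V') :
    g.baseChange ℂ x ∈ (LinearMap.range g).baseChange ℂ := by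
  induction x using TensorProduct.induction_on with
  | zero => rw [map_zero]; exact Submodule.zero_mem _
  | tmul c v =>
    rw [LinearMap.baseChange_tmul]
    exact Submodule.tmul_mem_baseChange_of_mem c (LinearMap.mem_range_self g v)
  | add x y hx hy => rw [map_add]; exact Submodule.add_mem _ hx hy

end RationalStructure

/-- **Every element of `(im j^*_ℚ)_ℂ` complexifies to the restriction of a global complex class**:
for `x ∈ (im j_t^*)_ℂ ⊆ ℂ ⊗_ℚ Hᵏ(X_t(ℂ); ℚ)`, `(x ↦ H^k(X_t(ℂ); ℂ))(x) = j_t^* W'` for some `W' ∈ Hᵏ(𝒳(ℂ); ℂ)`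
(`c ⊗ j^* v ↦ c · j^*(v ⊗ 1) = j^*(c · (v ⊗ 1))`). [cite: VoisinHodgeI2002, §7.1.1] -/
theorem exists_map_fiberι_eq_of_mem_baseChange_range {f : 𝒳 ⟶ S} (t : ComplexPoints S) (k : ℕ)
    {x : ℂ ⊗[ℚ] singularCohomology ℚ ℚ (ComplexPoints (fiberOver f t)) k}
    (hx : x ∈ (LinearMap.range
      (singularCohomology.map ℚ ℚ (Motives.AlgPoints.mapContinuous (L := ℂ) (fiberι f t)) k).hom).baseChange ℂ) :
    ∃ W' : complexBetti 𝒳 k,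
      ofRatClassBaseChange (ComplexPoints (fiberOver f t)) k x = complexBetti.map (fiberι f t) k W' := by
  obtain ⟨z, rfl⟩ := hx
  induction z using TensorProduct.induction_on with
  | zero => exact ⟨0, by rw [map_zero, map_zero, map_zero]⟩
  | tmul c v =>
    obtain ⟨v', hv'⟩ := v.2
    refine ⟨c • ofRatClass (ComplexPoints 𝒳) k v', ?_⟩
    rw [LinearMap.baseChange_tmul, Submodule.subtype_apply, ofRatClassBaseChange_tmul, map_smul, ← hv']
    exact congrArg (c • ·) (ofRatClass_map k _ v')
  | add z₁ z₂ h₁ h₂ =>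
    obtain ⟨W₁, hW₁⟩ := h₁
    obtain ⟨W₂, hW₂⟩ := h₂
    exact ⟨W₁ + W₂, by rw [map_add, map_add, hW₁, hW₂, map_add]⟩

/-- **Deligne's kernel identity at one fibre, from the named fact.** For a compact pencil `f : 𝒳 ⟶ S` of abelian
`d`-folds, a point `t` and a global `W ∈ H²ᵖ(𝒳(ℂ); ℂ)`: if `j_{t*} j_t^* W = 0` then `j_t^* W = 0` — granted
`h418 : deligne1968_invariantClass_fromTotalSpace`. `d = 0` is elementary (part XI); for `1 ≤ d`: `a = j_t^* W` is the complexification of an element `m` of `(im j^*_ℚ)_ℂ`, `im j^*_ℚ` underlies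
a sub-Hodge structure of the polarised `ℚ`-Hodge structure `Hᵏ(X_t(ℂ); ℚ)` (`hodgeStructureHom`,
`Hom.exists_subHodgeStructure_range`, `KaehlerRationalDatum.polarization`), the polarisation pairs `m` to zero
with that sub-Hodge structure (§1, through `form_baseChange`), hence `m = 0`
(`Polarization.eq_zero_of_forall_mem_baseChange`). [cite: Decataldo2007, Ex. 8.5.2–8.5.3]
[cite: Voisin2025, Prop. 2.11] [cite: VoisinHodgeI2002, Lemma 7.26 and §7.3.2] [cite: VoisinHodgeII2003, §4.3.1 Thm. 4.18] -/
theorem map_fiberι_eq_zero_of_fiberGysin_eq_zero_of_deligne1968 (h418 : deligne1968_invariantClass_fromTotalSpace)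
    {d : ℕ} {f : 𝒳 ⟶ S} (hf : IsCompactAbelianPencil f d) (t : ComplexPoints S) {p : ℕ}
    (W : complexBetti 𝒳 (2 * p)) (hW : fiberGysin hf t p (complexBetti.map (fiberι f t) (2 * p) W) = 0) :
    complexBetti.map (fiberι f t) (2 * p) W = 0 := by
  classical
  rcases Nat.eq_zero_or_pos d with rfl | hd
  · exact (fibreGysinKernelOn_of_relDim_zero hf) p t t W hW
  set hXt := hf.isSmoothProjective_fiberOver t
  have h𝒳 := hf.isSmoothProjective_total
  obtain ⟨K, D, hKD, hK⟩ := exists_globalKaehlerClass hf hd t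
  -- Hodge models and the morphism of `ℚ`-Hodge structures `j_t^*`
  obtain ⟨A, hAr⟩ := exists_isReal_hodgeModel_holds d (fiberOver f t) hXt
  obtain ⟨Bm, hBr⟩ := exists_isReal_hodgeModel_holds (d + 1) 𝒳 h𝒳
  have hA := hAr.isHodgeSymmetric
  have hB := hBr.isHodgeSymmetric
  let φ := Bm.hodgeStructureHom h𝒳 hodgePQ_independent_of_hodgeModel_holds hB A hXt hA (fiberι f t) (2 * p)
  obtain ⟨Ssub, hS⟩ := φ.exists_subHodgeStructure_range
  let Q := D.polarization hXt A hA (2 * p)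
  -- `a = j^* W` as the complexification of `m ∈ (im j^*_ℚ)_ℂ`
  obtain ⟨w, hw⟩ := ofRatClassBaseChange_surjective h𝒳 (2 * p) W
  set m := φ.toLinearMap.baseChange ℂ w with hm
  have hm_eq : ofRatClassBaseChange (ComplexPoints (fiberOver f t)) (2 * p) m =
      complexBetti.map (fiberι f t) (2 * p) W := by
    rw [← hw, hm, HodgeModel.hodgeStructureHom_toLinearMap]
    exact HodgeModel.ofRatClassBaseChange_baseChange_map (fiberι f t) (2 * p) w
  have hm_mem : m ∈ Ssub.toSubmodule.baseChange ℂ := by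
    rw [hS]
    exact baseChange_mem_baseChange_range φ.toLinearMap w
  -- the polarisation pairs `m` to zero with the sub-Hodge structure
  have h0 : ∀ x ∈ Ssub.toSubmodule.baseChange ℂ, Q.form.baseChange ℂ x m = 0 := by
    intro x hx
    rw [hS, HodgeModel.hodgeStructureHom_toLinearMap] at hx
    obtain ⟨W', hW'⟩ := exists_map_fiberι_eq_of_mem_baseChange_range t (2 * p) hx
    change (D.form hXt (2 * p)).baseChange ℂ x m = 0
    rw [D.form_baseChange hXt, hm_eq, hW']
    exact cform_map_fiberι_eq_zero_of_fiberGysin_eq_zero h418 hf t hK D hKD hW W'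
  have hm0 : m = 0 := Q.eq_zero_of_forall_mem_baseChange Ssub hm_mem h0
  rw [← hm_eq, hm0, map_zero]

/-! ## §3 (κ_f), (κ) from the named fact; the `K[κ]` rows of the Lefschetz column become `K[h418]` -/

/-- **(κ_f) `FibreGysinKernelOn hf` for EVERY compact pencil of abelian varieties, from the named fact
`deligne1968_invariantClass_fromTotalSpace`** (same fibre: §2; change of fibre: André's flatness (A4), a tree
theorem, `fibreGysinKernelOn_iff_sameFibre`). [cite: DeligneHodgeII1971, Thm. 4.1.1 and 4.2.6]
[cite: VoisinHodgeII2003, §4.3.1 Thm. 4.18] [cite: Andre1996Motifs, §5.1 (p. 25)] -/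
theorem fibreGysinKernelOn_of_deligne1968 (h418 : deligne1968_invariantClass_fromTotalSpace)
    {d : ℕ} {f : 𝒳 ⟶ S} (hf : IsCompactAbelianPencil f d) : FibreGysinKernelOn hf :=
  (fibreGysinKernelOn_iff_sameFibre hf).2 fun _ t W hW ↦
    map_fiberι_eq_zero_of_fiberGysin_eq_zero_of_deligne1968 h418 hf t W hW

/-- **(κ) `FibreGysinKernelCompactPencils` from the named fact**: the supply node of parts X-b/X-c is a
consequence of Voisin II Thm. 4.18 / Deligne 1968 and tree theorems. [cite: DeligneHodgeII1971, Thm. 4.1.1 and 4.2.6]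
[cite: VoisinHodgeII2003, §4.3.1 Thm. 4.18] -/
theorem fibreGysinKernelCompactPencils_of_deligne1968 (h418 : deligne1968_invariantClass_fromTotalSpace) :
    FibreGysinKernelCompactPencils :=
  fun _ _ _ _ hf ↦ fibreGysinKernelOn_of_deligne1968 h418 hf

/-- **ON-PATH for (β∀′ᵖᵗ) modulo the named fact only: `h418 → HodgeConjecture → (β∀′ᵖᵗ)`** (part X-c's
row with κ discharged to `h418`). [cite: Andre1996Motifs, §6.3 Remarque 2 (p. 33)] [cite: VoisinHodgeII2003, §4.3.1 Thm. 4.18] -/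
theorem fibreClassLefschetzPointwiseCompactPencils_of_hodgeConjecture_of_deligne1968
    (h418 : deligne1968_invariantClass_fromTotalSpace) (h : _root_.HodgeConjecture) :
    FibreClassLefschetzPointwiseCompactPencils :=
  fibreClassLefschetzPointwiseCompactPencils_of_hodgeConjecture (fibreGysinKernelCompactPencils_of_deligne1968 h418) h

/-- `(β′ᵖᵗ_f)` from `h418` and the codimension-`d` Hodge classes of `𝒳 × 𝒳` alone (part X-d's row, κ
discharged). [cite: Abdulali1994FamiliesAV, Conjecture 5.3 and Remark 5.4 (p. 1130)] [cite: VoisinHodgeII2003, §4.3.1 Thm. 4.18] -/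
theorem fibreClassLefschetzPointwiseOn_of_codim_of_deligne1968 (h418 : deligne1968_invariantClass_fromTotalSpace)
    {d : ℕ} {f : 𝒳 ⟶ S} (hf : IsCompactAbelianPencil f d)
    (halg : ∀ c : complexBetti (𝒳 ⊗ 𝒳) (2 * d), IsRationalClass c →
      IsOfHodgeType ((d + 1) + (d + 1)) (𝒳 ⊗ 𝒳) (2 * d) d d c → c ∈ algebraicClasses (𝒳 ⊗ 𝒳) d) :
    FibreClassLefschetzPointwiseOn hf :=
  fibreClassLefschetzPointwiseOn_of_codim hf (fibreGysinKernelOn_of_deligne1968 h418 hf) halg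

/-- ON-PATH for (β∀′) modulo `h418` and fibre-class constancy (φ) (part X-b's row, κ discharged).
[cite: Andre1996Motifs, §6.3 Remarque 2 (p. 33)] [cite: VoisinHodgeII2003, §4.3.1 Thm. 4.18] -/
theorem fibreClassLefschetzOnCompactPencils_of_hodgeConjecture_of_deligne1968
    (h418 : deligne1968_invariantClass_fromTotalSpace) (hφ : FibreClassConstantCompactPencils)
    (h : _root_.HodgeConjecture) : FibreClassLefschetzOnCompactPencils :=
  fibreClassLefschetzOnCompactPencils_of_hodgeConjecture (fibreGysinKernelCompactPencils_of_deligne1968 h418) hφ h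

/-- Under the Hodge conjecture, `h418` alone gives the whole transport ladder of the André axis through the
Lefschetz-type node: (β∀′ᵖᵗ), (L∀), (2), (L), (3), (4) (part X-c's ladder, κ discharged).
[cite: Andre1996Motifs, §6.3 Remarque 2 (p. 33)] [cite: VoisinHodgeII2003, §4.3.1 Thm. 4.18] -/
theorem lefschetzLadder_of_hodgeConjecture_of_deligne1968 (h418 : deligne1968_invariantClass_fromTotalSpace)
    (h : _root_.HodgeConjecture) :
    FibreClassLefschetzPointwiseCompactPencils ∧ AlgebraicFixedPart ∧ Deform.CompactAbelianPencilVHC ∧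
      CMFibreAlgebraicLift ∧ CMPointedPencilVHC ∧ CMAnchoredTransport :=
  lefschetzLadder_of_hodgeConjecture_of_kernel (fibreGysinKernelCompactPencils_of_deligne1968 h418) h

/-- Under the Hodge conjecture the pointwise Lefschetz-type node holds outright modulo `h418`, so part X-c's
`HC ⊢ (β∀′ᵖᵗ) ⟺ (κ)` makes (κ) itself a consequence of `HC` and `h418` — recorded as the pair.
[cite: VoisinHodgeII2003, §4.3.1 Thm. 4.18] -/
theorem kernel_and_pointwise_of_hodgeConjecture_of_deligne1968 (h418 : deligne1968_invariantClass_fromTotalSpace)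
    (h : _root_.HodgeConjecture) :
    FibreGysinKernelCompactPencils ∧ FibreClassLefschetzPointwiseCompactPencils :=
  ⟨fibreGysinKernelCompactPencils_of_deligne1968 h418,
    fibreClassLefschetzPointwiseCompactPencils_of_hodgeConjecture_of_deligne1968 h418 h⟩

/-- **The W₆ row with every input named, κ discharged**: `(W_E)₃ ∧ h418 ∧ (φ) ∧ HC^6(squares of the
7-dimensional total spaces) ⟹ WeilSixfolds` (part X-e's row). No `HC_CM`. research route, not a corollary;
conditional on HC_CM plus one named minimal statement. [cite: Andre1996Motifs, §6.3 Remarque 2 (p. 33)]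
[cite: VoisinHodgeII2003, §4.3.1 Thm. 4.18] -/
theorem weilSixfolds_of_cmPowerWeilPencilsAt_of_deligne1968_of_codimSix (hW : CMPowerAnchoredCompactWeilPencilsAt 3)
    (h418 : deligne1968_invariantClass_fromTotalSpace) (hφ : FibreClassConstantCompactPencils)
    (halg : ∀ ⦃𝒳 S : SchemeOver ℂ⦄ ⦃f : 𝒳 ⟶ S⦄, IsCompactAbelianPencil f 6 →
      ∀ c : complexBetti (𝒳 ⊗ 𝒳) (2 * 6), IsRationalClass c →
        IsOfHodgeType ((6 + 1) + (6 + 1)) (𝒳 ⊗ 𝒳) (2 * 6) 6 6 c → c ∈ algebraicClasses (𝒳 ⊗ 𝒳) 6) :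
    Theses.SevenfoldWeilCensus.WeilSixfolds :=
  weilSixfolds_of_cmPowerWeilPencilsAt_of_kernel_of_codimSix hW (fibreGysinKernelCompactPencils_of_deligne1968 h418)
    hφ halg

/-- **`HC_CM ∧ h418 ∧ HC^{pointwise Lefschetz content} …`: the cell row through the pointwise node, κ discharged**:
`HC_CM → h418 → HodgeConjecture-for-the-squares … ` is not needed — the clean statement is part X-c's
`HC_AV_of_HC_CM_and_fibreClassLefschetzPointwiseCMPointedPencils`; here we record that its Lefschetz-type
hypothesis is implied by `HC` modulo `h418` (`fibreClassLefschetzPointwiseCMPointedPencils_of_compactPencils`).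
[cite: Andre1996Motifs, Lemme 6.3.1 (p. 31) and Remarque 2 (p. 33)] -/
theorem fibreClassLefschetzPointwiseCMPointedPencils_of_hodgeConjecture_of_deligne1968
    (h418 : deligne1968_invariantClass_fromTotalSpace) (h : _root_.HodgeConjecture) :
    FibreClassLefschetzPointwiseCMPointedPencils :=
  fibreClassLefschetzPointwiseCMPointedPencils_of_compactPencils
    (fibreClassLefschetzPointwiseCompactPencils_of_hodgeConjecture_of_deligne1968 h418 h)

end Summit.HodgeConjecture.HodgeConjecture.Ring2.AbelianAll

end
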